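import Literature.NumberTheory.GaloisRepresentations.PrimeSquareCyclic
import Literature.NumberTheory.NumberFields.UnramifiedViaInertia
import Mathlib.GroupTheory.FiniteAbelian.Basic
import Mathlib.NumberTheory.RamificationInertia.Unramified
import HarnessLib

/-!
# Abelian `p`-power extensions of `ℚ` unramified outside `p` are cyclic, and unique in each degree

The uniqueness half of the odd part of the Kronecker–Weber theorem, after Marcus, *Number Fields*
(2nd ed. 2018), Ch. 4, Ex. 34–36, deduced from the global form of Ex. 34
(`isCyclic_of_card_eq_prime_sq`, `GaloisRepresentations/PrimeSquareCyclic.lean`) and Minkowski's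
theorem (`inertia_eq_top_of_isUnramifiedAt`, `InertiaGeneratesGalois.lean`):

* `exists_subgroup_index_eq_sq_not_isCyclic` — a noncyclic finite abelian `p`-group has a
  noncyclic quotient of order `p²` (structure theorem).
* `isCyclic_of_isUnramifiedAt_of_card_eq_prime_pow` — an abelian number field `M` of odd
  `p`-power degree in which every prime not above `p` is unramified has cyclic `Gal(M/ℚ)`:
  otherwise some subfield `M'` has `Gal(M'/ℚ)` noncyclic of order `p²`, although `p` is totally
  ramified in `M'` with residue degree `1` (Minkowski), contradicting Ex. 34 over `ℤ`.
* `Subgroup.eq_of_index_eq_of_isCyclic` — in a finite cyclic group a subgroup is determined by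
  its index.
* `IntermediateField.eq_of_inertia_le_of_finrank_eq` — inside an abelian number field `M₀`, two
  subfields of the same degree `pᵏ` which are unramified outside `p` (phrased by inertia groups
  of `𝓞 M₀`, `UnramifiedViaInertia.lean`) coincide: their compositum is cyclic over `ℚ` by the
  previous result, and in a cyclic group the two subgroups have the same index (Marcus, Ex. 35–36).

The existence half (the layer of degree `pᵏ` of `ℚ(ζ_{p^{k+1}})`) and the conclusion
"`F ⊆ ℚ(ζ_{p^{k+1}})`" are drawn in `OddPrimePowerKW.lean`.

## References

* D. A. Marcus, *Number Fields*, 2nd ed., Universitext, Springer (2018), Ch. 4, Ex. 34–36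
  (pp. 102–103). [Marcus2018]
-/

noncomputable section

open NumberField Ideal
open scoped Pointwise IsMulCommutative

namespace Literature.NumberTheory.NumberFields

/-! ### A noncyclic finite abelian `p`-group has a noncyclic quotient of order `p²` -/

/-- A finite commutative `p`-group which is not cyclic has a quotient of order `p²` which is not
cyclic (i.e. is elementary abelian of rank `2`): by the structure theorem it is a product of at
least two cyclic `p`-groups, which maps onto `ℤ/p × ℤ/p`. [folklore] -/
theorem exists_subgroup_index_eq_sq_not_isCyclic {G : Type*} [CommGroup G] [Finite G] {p : ℕ}
    (hp : p.Prime) (hG : IsPGroup p G) (hnc : ¬ IsCyclic G) :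
    ∃ N : Subgroup G, N.index = p ^ 2 ∧ ¬ IsCyclic (G ⧸ N) := by
  classical
  haveI : Fact p.Prime := ⟨hp⟩
  obtain ⟨ι, _, n, hn, ⟨e⟩⟩ := CommGroup.equiv_prod_multiplicative_zmod_of_finite G
  -- each `n i` is a multiple of `p` (it is the order of an element of the `p`-group `G`)
  have hdvd : ∀ i, p ∣ n i := by
    intro i
    haveI : NeZero (n i) := ⟨by have := hn i; omega⟩
    set g : (i : ι) → Multiplicative (ZMod (n i)) := Pi.mulSingle i (Multiplicative.ofAdd 1)
    have hg : orderOf g = n i := by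
      rw [orderOf_piMulSingle, orderOf_ofAdd_eq_addOrderOf, ZMod.addOrderOf_one]
    obtain ⟨k, hk⟩ := hG (e.symm g)
    have h1 : orderOf (e.symm g) ∣ p ^ k := orderOf_dvd_of_pow_eq_one hk
    rw [MulEquiv.orderOf_eq, hg] at h1
    obtain ⟨a, -, ha⟩ := (Nat.dvd_prime_pow hp).mp h1
    rcases a with _ | a
    · rw [pow_zero] at ha; have := hn i; omega
    · rw [ha, pow_succ]; exact dvd_mul_left p _
  -- there are at least two factors
  rcases subsingleton_or_nontrivial ι with hι | hι
  · exfalso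
    apply hnc
    rcases isEmpty_or_nonempty ι with hι' | ⟨⟨i⟩⟩
    · haveI : Unique ((i : ι) → Multiplicative (ZMod (n i))) := Pi.uniqueOfIsEmpty _
      haveI : Subsingleton G := e.toEquiv.subsingleton
      infer_instance
    · haveI : Unique ι := uniqueOfSubsingleton i
      let e' : G ≃* Multiplicative (ZMod (n default)) :=
        e.trans (MulEquiv.piUnique fun i => Multiplicative (ZMod (n i)))
      exact isCyclic_of_surjective e'.symm.toMonoidHom e'.symm.surjective
  obtain ⟨i, j, hij⟩ := hι
  -- the surjection onto `ℤ/p × ℤ/p`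
  let π : ((i : ι) → Multiplicative (ZMod (n i))) →* Multiplicative (ZMod p) × Multiplicative (ZMod p) :=
    MonoidHom.prod
      ((AddMonoidHom.toMultiplicative (ZMod.castHom (hdvd i) (ZMod p)).toAddMonoidHom).comp
        (Pi.evalMonoidHom _ i))
      ((AddMonoidHom.toMultiplicative (ZMod.castHom (hdvd j) (ZMod p)).toAddMonoidHom).comp
        (Pi.evalMonoidHom _ j))
  have hπ : Function.Surjective π := by
    rintro ⟨a, b⟩
    obtain ⟨a', ha'⟩ := ZMod.castHom_surjective (hdvd i) (Multiplicative.toAdd a)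
    obtain ⟨b', hb'⟩ := ZMod.castHom_surjective (hdvd j) (Multiplicative.toAdd b)
    refine ⟨Pi.mulSingle i (Multiplicative.ofAdd a') * Pi.mulSingle j (Multiplicative.ofAdd b'), ?_⟩
    simp [π, hij, hij.symm, ha', hb']
  set f : G →* Multiplicative (ZMod p) × Multiplicative (ZMod p) := π.comp e.toMonoidHom with hf
  have hfs : Function.Surjective f := hπ.comp e.surjective
  refine ⟨f.ker, ?_, ?_⟩
  · rw [Subgroup.index_ker, MonoidHom.range_eq_top.mpr hfs, Subgroup.card_top, Nat.card_prod,
      Nat.card_eq_fintype_card, Fintype.card_multiplicative, ZMod.card, pow_two]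
  · intro hc
    haveI := hc
    have hc' : IsCyclic (Multiplicative (ZMod p) × Multiplicative (ZMod p)) :=
      isCyclic_of_surjective (QuotientGroup.quotientKerEquivOfSurjective f hfs).toMonoidHom
        (MulEquiv.surjective _)
    have hcard : Nat.card (Multiplicative (ZMod p) × Multiplicative (ZMod p)) = p ^ 2 := by
      rw [Nat.card_prod, Nat.card_eq_fintype_card, Fintype.card_multiplicative, ZMod.card, pow_two]
    refine (not_isCyclic_iff_exponent_eq_prime hp hcard).mpr ?_ hc'
    rw [Monoid.exponent_prod, Monoid.exponent_multiplicative, ZMod.exponent]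
    simp

/-! ### Abelian `p`-power extensions of `ℚ` unramified outside `p` have cyclic Galois group -/

/-- **Marcus, *Number Fields*, Ch. 4, Ex. 34–35 (group-theoretic form).**  Let `M` be an abelian
number field whose degree is a power of the odd prime `p` and which is unramified at every prime
not above `p`.  Then `Gal(M/ℚ)` is cyclic.  Otherwise `Gal(M/ℚ)` has a noncyclic quotient of
order `p²` (`exists_subgroup_index_eq_sq_not_isCyclic`), i.e. `M` contains an abelian `M'` of
degree `p²` over `ℚ`, again unramified outside `p`, with `Gal(M'/ℚ)` not cyclic; but `p` is
totally ramified in `M'` with residue degree `1` (Minkowski: `inertia_eq_top_of_isUnramifiedAt`,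
`inertiaDeg_eq_one_of_inertia_eq_top`), so `Gal(M'/ℚ)` is cyclic by Marcus's Ex. 34
(`isCyclic_of_card_eq_prime_sq` with `R = ℤ`: `p ∉ (p)²`). [cite: Marcus2018, Ch. 4, Ex. 34–35 (pp. 102–103)] -/
theorem isCyclic_of_isUnramifiedAt_of_card_eq_prime_pow {M : Type*} [Field M] [NumberField M]
    [IsAbelianGalois ℚ M] {p k : ℕ} (hp : p.Prime) (hp2 : p ≠ 2)
    (hcard : Nat.card (M ≃ₐ[ℚ] M) = p ^ k)
    (hunr : ∀ (Q : Ideal (𝓞 M)) [Q.IsMaximal], (p : 𝓞 M) ∉ Q → Algebra.IsUnramifiedAt ℤ Q) :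
    IsCyclic (M ≃ₐ[ℚ] M) := by
  classical
  by_contra hnc
  obtain ⟨N, hNi, hNc⟩ :=
    exists_subgroup_index_eq_sq_not_isCyclic hp (IsPGroup.of_card hcard) hnc
  haveI : N.Normal := inferInstance
  set M' : IntermediateField ℚ M := IntermediateField.fixedField N with hM'
  haveI : IsGalois ℚ M' := IsGalois.of_fixedField_normal_subgroup N
  haveI hab : IsAbelianGalois ℚ M' := IsAbelianGalois.tower_bot ℚ M' M
  haveI : IsMulCommutative (M' ≃ₐ[ℚ] M') := hab.toIsMulCommutative
  haveI : IsDedekindDomain (integralClosure ℤ M') := integralClosure.isDedekindDomain ℤ ℚ M'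
  -- `Gal(M'/ℚ) ≅ Gal(M/ℚ)/N` has order `p²` and is not cyclic
  let e : (M ≃ₐ[ℚ] M) ⧸ N ≃* (M' ≃ₐ[ℚ] M') := IsGalois.normalAutEquivQuotient N
  have hcard' : Nat.card (M' ≃ₐ[ℚ] M') = p ^ 2 := by
    rw [← Nat.card_congr e.toEquiv]; exact hNi
  have hnc' : ¬ IsCyclic (M' ≃ₐ[ℚ] M') := fun h =>
    hNc (isCyclic_of_surjective e.symm.toMonoidHom e.symm.surjective)
  -- a prime `𝔓'` of `M'` above `p`
  haveI hpmax : (Ideal.span {(p : ℤ)}).IsMaximal :=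
    Ideal.IsPrime.isMaximal
      ((Ideal.span_singleton_prime (by exact_mod_cast hp.ne_zero)).mpr
        (Nat.prime_iff_prime_int.mp hp)) (by simpa using hp.ne_zero)
  obtain ⟨𝔓', h𝔓'max, h𝔓'over⟩ :=
    Ideal.exists_maximal_ideal_liesOver_of_isIntegral (S := 𝓞 M') (Ideal.span {(p : ℤ)})
  have h𝔓'ne : 𝔓' ≠ ⊥ := Ideal.IsMaximal.ne_bot_of_isIntegral_int 𝔓'
  have hpP : (p : 𝓞 M') ∈ 𝔓' := by
    have : algebraMap ℤ (𝓞 M') (p : ℤ) ∈ 𝔓' :=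
      (Ideal.mem_of_liesOver 𝔓' (Ideal.span {(p : ℤ)}) (p : ℤ)).mp
        (Ideal.mem_span_singleton_self _)
    simpa using this
  have hunder : 𝔓'.under ℤ = Ideal.span {(p : ℤ)} := h𝔓'over.over.symm
  -- `M'` is unramified outside `p` (descend from `M`)
  have hunr' : ∀ (Q : Ideal (𝓞 M')) [Q.IsMaximal], Q.under ℤ ≠ 𝔓'.under ℤ →
      Algebra.IsUnramifiedAt ℤ Q := by
    intro Q _ hQ
    obtain ⟨Q₁, hQ₁max, hQ₁over⟩ := Ideal.exists_maximal_ideal_liesOver_of_isIntegral (S := 𝓞 M) Q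
    have hpQ₁ : (p : 𝓞 M) ∉ Q₁ := by
      intro hmem
      apply hQ
      rw [hunder]
      have hpQ : (p : 𝓞 M') ∈ Q := by
        have : (algebraMap (𝓞 M') (𝓞 M) (p : 𝓞 M')) ∈ Q₁ := by simpa using hmem
        rwa [← Ideal.mem_comap, ← Ideal.under_def, ← hQ₁over.over] at this
      have hle : Ideal.span {(p : ℤ)} ≤ Q.under ℤ := by
        rw [Ideal.span_singleton_le_iff_mem, Ideal.under_def, Ideal.mem_comap, map_natCast]
        exact hpQ
      exact (hpmax.eq_of_le (Ideal.IsMaximal.under ℤ Q).ne_top hle).symm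
    haveI := hunr Q₁ hpQ₁
    exact Algebra.IsUnramifiedAt.of_liesOver ℤ Q Q₁
  -- hence `p` is totally ramified in `M'`, with residue degree `1`
  have htot : 𝔓'.inertia (M' ≃ₐ[ℚ] M') = ⊤ :=
    inertia_eq_top_of_isUnramifiedAt M' (M' ≃ₐ[ℚ] M') 𝔓' hunr'
  have hf := (inertiaDeg_eq_one_of_inertia_eq_top M' (M' ≃ₐ[ℚ] M') 𝔓' htot).1
  have hres : Nat.card (𝓞 M' ⧸ 𝔓') = p := by
    have h1 := Ideal.pow_inertiaDeg p 𝔓'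
    rw [hf, pow_one, Ideal.absNorm_apply, Submodule.cardQuot_apply] at h1
    exact h1.symm
  haveI : Finite (𝓞 M' ⧸ 𝔓') := Ideal.finiteQuotientOfFreeOfNeBot 𝔓' h𝔓'ne
  have hp𝔭 : (p : ℤ) ∉ (𝔓'.under ℤ) ^ 2 := by
    rw [hunder, Ideal.span_singleton_pow, Ideal.mem_span_singleton]
    intro h
    have h' : p ^ 2 ∣ p := by exact_mod_cast h
    have := Nat.le_of_dvd hp.pos h'
    nlinarith [hp.two_le]
  -- Ex. 34 over `ℤ` (the ring of integers `𝓞 M'` is the type `integralClosure ℤ M'`)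
  haveI : (show Ideal (integralClosure ℤ M') from 𝔓').IsMaximal := h𝔓'max
  haveI : Finite (integralClosure ℤ M' ⧸ (show Ideal (integralClosure ℤ M') from 𝔓')) :=
    ‹Finite (𝓞 M' ⧸ 𝔓')›
  haveI : Module.IsTorsionFree ℤ (integralClosure ℤ M') := by
    haveI := Literature.NumberTheory.GaloisRepresentations.faithfulSMul_integralClosure ℤ
      (K := ℚ) (L := M')
    rw [Module.isTorsionFree_iff_faithfulSMul]; infer_instance
  exact hnc' (Literature.NumberTheory.GaloisRepresentations.isCyclic_of_card_eq_prime_sq ℤ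
    (K := ℚ) (L := M') (show Ideal (integralClosure ℤ M') from 𝔓') h𝔓'ne hp hp2 hcard' hres
    htot hpP hp𝔭)

/-! ### In a finite cyclic group a subgroup is determined by its index -/

/-- In a finite cyclic (commutative) group, a subgroup is the group of `d`-th powers, `d` its
index; hence two subgroups with the same index coincide. [folklore] -/
theorem _root_.Subgroup.eq_of_index_eq_of_isCyclic {Γ : Type*} [CommGroup Γ] [IsCyclic Γ]
    [Finite Γ] {A B : Subgroup Γ} (h : A.index = B.index) : A = B := by
  have key : ∀ C : Subgroup Γ, C = (powMonoidHom C.index : Γ →* Γ).range := by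
    intro C
    symm
    refine Subgroup.eq_of_le_of_card_ge ?_ ?_
    · rintro _ ⟨g, rfl⟩
      exact C.pow_index_mem g
    · rw [IsCyclic.card_powMonoidHom_range, Nat.gcd_eq_right C.index_dvd_card]
      exact (Nat.div_eq_of_eq_mul_left (Nat.pos_of_ne_zero C.index_ne_zero_of_finite)
        C.card_mul_index.symm).ge
  rw [key A, key B, h]

/-! ### Two subfields of `p`-power degree unramified outside `p` coincide -/

/-- **Marcus, *Number Fields*, Ch. 4, Ex. 35–36 (uniqueness), inside an abelian number field.**
Let `M₀` be an abelian number field with group `G`, `p` an odd prime, and `F`, `C` two subfields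
of the same degree `pᵏ` over `ℚ`, both unramified outside `p` in the sense that `I(Q) ≤ Gal(M₀/F)`
and `I(Q) ≤ Gal(M₀/C)` for every maximal ideal `Q ∌ p` of `𝓞 M₀`
(`isUnramifiedAt_under_iff_inertia_le`).  Then `F = C`.  For the compositum `N = FC` is an
abelian number field of `p`-power degree unramified outside `p`, hence has cyclic Galois group
`G / (H_F ∩ H_C)` (`isCyclic_of_isUnramifiedAt_of_card_eq_prime_pow`), in which the images of
`H_F` and `H_C` have the same index `pᵏ`, so coincide.  (Marcus: "`F ∩ L = ℚ` … conclude that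
`K = L`".) [cite: Marcus2018, Ch. 4, Ex. 35–36 (p. 103)] -/
theorem IntermediateField.eq_of_inertia_le_of_finrank_eq {M₀ : Type*} [Field M₀] [NumberField M₀]
    [IsAbelianGalois ℚ M₀] {p k : ℕ} (hp : p.Prime) (hp2 : p ≠ 2) (F C : IntermediateField ℚ M₀)
    (hF : Module.finrank ℚ F = p ^ k) (hC : Module.finrank ℚ C = p ^ k)
    (hFu : ∀ (Q : Ideal (𝓞 M₀)) [Q.IsMaximal], (p : 𝓞 M₀) ∉ Q →
      Q.inertia (M₀ ≃ₐ[ℚ] M₀) ≤ F.fixingSubgroup)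
    (hCu : ∀ (Q : Ideal (𝓞 M₀)) [Q.IsMaximal], (p : 𝓞 M₀) ∉ Q →
      Q.inertia (M₀ ≃ₐ[ℚ] M₀) ≤ C.fixingSubgroup) :
    F = C := by
  classical
  set HF := F.fixingSubgroup with hHF
  set HC := C.fixingSubgroup with hHC
  set H := HF ⊓ HC with hH
  haveI : H.Normal := inferInstance
  haveI : HC.Normal := inferInstance
  -- indices
  have hindex : ∀ (E : IntermediateField ℚ M₀), E.fixingSubgroup.index = Module.finrank ℚ E := by
    intro E
    have h1 := E.fixingSubgroup.card_mul_index
    rw [IsGalois.card_fixingSubgroup_eq_finrank E, IsGalois.card_aut_eq_finrank,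
      ← Module.finrank_mul_finrank ℚ E M₀, mul_comm] at h1
    exact Nat.eq_of_mul_eq_mul_right (Module.finrank_pos (R := E) (M := M₀)) h1
  have hHF' : HF.index = p ^ k := (hindex F).trans hF
  have hHC' : HC.index = p ^ k := (hindex C).trans hC
  -- the compositum `N = M₀^H`, an abelian number field of `p`-power degree
  set N : IntermediateField ℚ M₀ := IntermediateField.fixedField H with hN
  haveI : IsGalois ℚ N := IsGalois.of_fixedField_normal_subgroup H
  haveI hab : IsAbelianGalois ℚ N := IsAbelianGalois.tower_bot ℚ N M₀
  have hNfix : N.fixingSubgroup = H := IntermediateField.fixingSubgroup_fixedField H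
  let e : (M₀ ≃ₐ[ℚ] M₀) ⧸ H ≃* (N ≃ₐ[ℚ] N) := IsGalois.normalAutEquivQuotient H
  have hcardN : ∃ j, Nat.card (N ≃ₐ[ℚ] N) = p ^ j := by
    have hdvd : H.index ∣ HC.index * HF.index := by
      rw [← Subgroup.relIndex_mul_index (inf_le_left : H ≤ HF), Subgroup.inf_relIndex_left]
      exact Nat.mul_dvd_mul_right (Subgroup.relIndex_dvd_index_of_normal HC HF) _
    rw [hHF', hHC', ← pow_add] at hdvd
    obtain ⟨j, -, hj⟩ := (Nat.dvd_prime_pow hp).mp hdvd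
    exact ⟨j, by rw [← Nat.card_congr e.toEquiv]; exact hj⟩
  obtain ⟨j, hj⟩ := hcardN
  -- `N` is unramified outside `p`
  have hNu : ∀ (q : Ideal (𝓞 N)) [q.IsMaximal], (p : 𝓞 N) ∉ q → Algebra.IsUnramifiedAt ℤ q := by
    rw [forall_isUnramifiedAt_iff_forall_inertia_le N p]
    intro Q _ hpQ
    rw [hNfix, hH]
    exact le_inf (hFu Q hpQ) (hCu Q hpQ)
  -- hence `G/H ≅ Gal(N/ℚ)` is cyclic
  haveI : IsCyclic (N ≃ₐ[ℚ] N) := isCyclic_of_isUnramifiedAt_of_card_eq_prime_pow hp hp2 hj hNu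
  haveI : IsCyclic ((M₀ ≃ₐ[ℚ] M₀) ⧸ H) := isCyclic_of_surjective e.symm.toMonoidHom e.symm.surjective
  -- the images of `HF` and `HC` in the cyclic group `G/H` have the same index, so coincide
  have hleF : (QuotientGroup.mk' H).ker ≤ HF := by rw [QuotientGroup.ker_mk']; exact inf_le_left
  have hleC : (QuotientGroup.mk' H).ker ≤ HC := by rw [QuotientGroup.ker_mk']; exact inf_le_right
  have hmap : HF.map (QuotientGroup.mk' H) = HC.map (QuotientGroup.mk' H) := by
    apply Subgroup.eq_of_index_eq_of_isCyclic
    rw [Subgroup.index_map_eq _ (QuotientGroup.mk'_surjective H) hleF,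
      Subgroup.index_map_eq _ (QuotientGroup.mk'_surjective H) hleC, hHF', hHC']
  have hHFC : HF = HC := by
    rw [← Subgroup.comap_map_eq_self hleF, ← Subgroup.comap_map_eq_self hleC, hmap]
  rw [← IsGalois.fixedField_fixingSubgroup F, ← IsGalois.fixedField_fixingSubgroup C, ← hHF,
    ← hHC, hHFC]

end Literature.NumberTheory.NumberFields
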